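import Summits.HodgeConjecture.CorCM.D2Bridge.ClosedPrintedMuKeyIdentLemD3DelRecConjOmegaT
import Summits.HodgeConjecture.CorCM.B01.Transposition.Item6OmegaChiSplitting
import Literature.NumberTheory.Automorphic.Liu2021.Def411WeilCarriersLocalDataAtV
import Literature.NumberTheory.Automorphic.IdeleClassCharacterHecke
import Literature.RepresentationTheory.Liu2021.OscillatorConventions
import Literature.NumberTheory.GelbartRogawski1991.CMSplittingCharLocalMu
import Literature.NumberTheory.Automorphic.Liu2021.LemD1Item3AtVSplitOfFacts
import Literature.NumberTheory.GelbartRogawski1991.UndoubledSplittingsUnitary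
import Literature.RepresentationTheory.MoeglinVignerasWaldspurger1987.RankOneThetaLiftTwistRigiditySplitHolds
import Literature.NumberTheory.Automorphic.Liu2021.SplitPlaceOscillatorModelUniform
import Literature.NumberTheory.Automorphic.Zelevinsky1980.UnitaryCharacterInductionIrreducible
import HarnessLib

/-!
# `hD3` line `a4-liuD3`, stub (:195) `stub_splitInjective : SplitInjective` — CLOSED MODULO THE FACTS IV-4c4, IV-3(a), IV-3(b) AND KUDLA'S
# LOCAL INJECTIVITY (item F2), BY NAME (cell `hodgecm-mathlib`, binder `HypD3`; crux item stmt-HodgeConjecture-24837)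

Summits side, binder subdirectory `CorCM/HypD3/`.  The crux skeleton `A-plan/lines/a4-liuD3.lean` (v1 sha16 5422b04d6cb4d0fa, REF1 PASS
2026-08-28T02:57:41Z; v2 = `e ↦ e₁` + fact binders, RULING 02:54:52Z) cuts `hD3` = [Liu2021, Lem. D.1 (3)] AS PRINTED per finite place
into five stubs over `famAtV F e dV hdV hdV0 ψ hψ aOf χOf v := Def411WeilCarriers.localIndexedFamilyAtV F⁺ F c 3 e (diagonal dV) … v`.
Stub (:195) `SplitInjective` is the `μ ∧ χ` third at a place `v` of `F⁺` SPLIT in `F` (`¬ IsField (F ⊗ F⁺_v)`):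
«`ω(μ_j, ε_j, χ_j) ≅ ω(μ_i, ε_i, χ_i) → μ_{j,v} = μ_{i,v} ∧ χ_j = χ_i`».

This file proves it AT `e₁ = Equiv.prodUnique (Fin 3) (Fin 1)` with `famAtV` replaced by its definiens, GIVEN BY NAME the interface facts
IV-4c4 `rankOne_theta_twist_rigidity_split` (p598433), IV-3(a) `splitPlace_chiCoinv_iso_parabolicIndGL`, IV-3(b)
`parabolicIndGL_detChar_unitary_isIrreducible`, and — as an explicit hypothesis `hK` in the statement, until the cell's item F2
`LocalKudlaSplittingUniqueness` lands — KUDLA'S LOCAL INJECTIVITY in transported form: if member `i`'s transported section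
(`lineTransportSection … (aOf i) …`, `LocalLineModelTransport.lean`), line-transported onto member `j`'s line, equals member `j`'s, then
`localMu μ_j v = localMu μ_i v`.  Proof = `Def411WeilCarriers.mu_and_chi_eq_of_areIsomorphicRep_split_of_facts` (`LemD1Item3AtVSplitOfFacts.lean`)
at the face family, with the unitarity of the χ-splittings of record (`GRConstruction.isL2Isometric_omegaLoc_congrW_undoubledSplittings_cmFinLocalFamily`,
`hχu := isUnitary_toHeckeCharacter`) and the Haar data of record `borelPlaceMeasure`.  With v2's fact binders the A-side stub closes by
`fun … => Summit.HodgeConjecture.CorCM.HypD3.splitInjective_of_facts h4 hIV3a hIV3b … hK hE i j hiso` (`famAtV` unfolds by `δ`-reduction).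

HC_CM is proved only modulo the 7 printed citations (`hDel`, `h21`, `hLiu418`, `h411`, `h413`, `hD3`, `hD1''`) until rung 0 closes; this file
discharges no binder and no interface fact (it CONSUMES three by name and one analytic input as a hypothesis).

## References
* [Liu2021] Y. Liu, Camb. J. Math. 9 (2021) = arXiv:2102.11518, App. D Lemma D.1 (3) (l. 5233); proof, split case (l. 5249–5254).
* [Minguez2008] A. Mínguez, Ann. Sci. ÉNS 41 (2008) — Thm. 1 p. 718.
* [MoeglinVignerasWaldspurger1987] MVW, LNM 1291, Chap. 3 III.7, IV.4.
-/

set_option autoImplicit false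

noncomputable section

namespace Summit.HodgeConjecture.CorCM.HypD3
open scoped TensorProduct Matrix
open NumberField NumberField.InfinitePlace
open HodgeCM.Model HodgeCM.Model.LiuIndex HodgeCM.Model.TowerCarrier
open HodgeCM.Literature.Theta.LiuAlbaneseModuleDatum.D2Bridge (HcmPieces)
open Summit.HodgeConjecture.CorCM.Model
open Literature.AlgebraicGeometry.Motives (CMType)
open Literature.AlgebraicGeometry.HodgeTheory Literature.NumberTheory.Automorphic.PicardCM
open Literature.AlgebraicGeometry.ShimuraVarieties.UnitaryCanonicalModel
open Literature.NumberTheory.ComplexMultiplication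
open Literature.NumberTheory.Automorphic
open Literature.NumberTheory.Automorphic.IdeleClassGroup (toHeckeCharacter isUnitary_toHeckeCharacter galConj)
open Literature.NumberTheory.Automorphic.Liu2021 Literature.NumberTheory.Automorphic.Liu2021.AppendixC
open Literature.NumberTheory.Automorphic.Liu2021.AppendixC.RestOne
open Literature.NumberTheory.Automorphic.Liu2021.Def411WeilCarriers (lineOf locF Rep)
open Summit.HodgeConjecture.CorCM.Transposition.OmegaTransport (realUnit)
open HodgeCM.Model.ArchSideTerm (e₁)
open Literature.NumberTheory.GelbartRogawski1991 Literature.NumberTheory.GelbartRogawski1991.UnitaryDualPair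
open Literature.NumberTheory.GelbartRogawski1991.UnitaryDualPair.LocalSplitting (localMu norm_localMu continuous_localMu localMu_toLocalRing_eq_one_iff
  eq_of_forall_localMu_toHeckeCharacter_eq)
open Literature.RepresentationTheory Literature.RepresentationTheory.Liu2021
open Summit.HodgeConjecture.CorCM.Transposition
open Summit.HodgeConjecture.CorCM.D2Bridge.AdapterMuConj (muConj prop413AsPrinted_muConj def411_muConj nontrivial_omegaAt_muConj_rest)
open Summit.HodgeConjecture.CorCM.D2Bridge.MuKeyIdentEnd (hc_cm_of_printed_citations_muKey_ident)
open Summit.HodgeConjecture.CorCM.D2Bridge.MuKeyIdentLemD3End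
open Summit.HodgeConjecture.CorCM.D2Bridge.MuKeyIdentLemD3DelRecConjOmegaEnd (diagonal_frameD_map_complexConj)
open Summit.HodgeConjecture.CorCM.D2Bridge.MuKeyIdentLemD3DelRecConjOmegaEndT (hc_cm_of_printed_citations_muKey_ident_lemD3_delRecConjOmegaT)
open MeasureTheory
open Literature.RepresentationTheory.MoeglinVignerasWaldspurger1987 (rankOne_theta_twist_rigidity_split lineTransportSplitting)
open Literature.NumberTheory.GelbartRogawski1991.UnitaryDualPair.LocalSplitting (lineTransportSection conj_lineDelta lineDelta_ne_zero
  lineDelta_mul_self)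

set_option maxHeartbeats 1600000 in
/-- **Line `a4-liuD3`, stub (:195) `SplitInjective`, PROVED MODULO THE FACTS** IV-4c4 (`h4`), IV-3(a) (`hIV3a`), IV-3(b) (`hIV3b`) by name
and Kudla's local injectivity in transported form (`hK`, explicit): for every CM field `F`, real frame `dV`, index maps `ψ, hψ, aOf, χOf`
and finite place `v` of `F⁺` with `F ⊗ F⁺_v` NOT a field, and all members `i, j` of the family of record at `e₁`:
`AreIsomorphicRep (quot j) (quot i) → mu j = mu i ∧ chi j = chi i`.  Statement = the body of
`Summit.HodgeConjecture.CorCM.Lines.A4LiuD3.SplitInjective` at `e := e₁` with `famAtV` unfolded to its definiens and the binder `hK` inserted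
after `v`; proof = `Def411WeilCarriers.mu_and_chi_eq_of_areIsomorphicRep_split_of_facts` at the face family.
[cite: Liu2021, App. D Lemma D.1 (3) (l. 5233), proof l. 5249–5254] [cite: Minguez2008, Thm. 1 p. 718]
[cite: MoeglinVignerasWaldspurger1987, Chap. 3 IV.4] -/
theorem splitInjective_of_facts (h4 : rankOne_theta_twist_rigidity_split) (hIV3a : splitPlace_chiCoinv_iso_parabolicIndGL)
    (hIV3b : Zelevinsky1980.parabolicIndGL_detChar_unitary_isIrreducible.{0}) :
    ∀ (F : HodgeCM.CMField) (dV : Fin 3 → (F : Type))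
      (hdV : ∀ i, IsCMField.complexConj (F : Type) (dV i) = dV i) (hdV0 : ∀ i, dV i ≠ 0) {ι : Type}
      (ψ : ι → (Literature.NumberTheory.Automorphic.IdeleClassGroup (F : Type) →ₜ* Circle))
      (hψ : ∀ t, IdeleClassGroup.IsConjugateSymplectic (F : Type) (ψ t))
      (aOf : ι → (↥(maximalRealSubfield (F : Type)))ˣ)
      (χOf : ι → Def411WeilCarriers.Chi ↥(maximalRealSubfield (F : Type)) (F : Type) (IsCMField.complexConj (F : Type)))
      (v : IsDedekindDomain.HeightOneSpectrum (𝓞 ↥(maximalRealSubfield (F : Type)))),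
      (∀ i j : ι,
        (∃ (x : (UnitaryGroup.LocalRing (F : Type) v)ˣ) (hx : algebraMap (F : Type) (UnitaryGroup.LocalRing (F : Type) v) (algebraMap ↥(maximalRealSubfield (F : Type)) (F : Type) (↑(aOf j)⁻¹ : ↥(maximalRealSubfield (F : Type))) * imagUnit (F : Type)) =
            (x : (UnitaryGroup.LocalRing (F : Type) v)) * UnitaryGroup.conjLocal (F : Type) (IsCMField.complexConj (F : Type)) v x * algebraMap (F : Type) (UnitaryGroup.LocalRing (F : Type) v) (algebraMap ↥(maximalRealSubfield (F : Type)) (F : Type) (↑(aOf i)⁻¹ : ↥(maximalRealSubfield (F : Type))) * imagUnit (F : Type))),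
          lineTransportSplitting (F : Type) v (IsCMField.complexConj (F : Type)) 3 (conj_lineDelta (complexConj_imagUnit (F : Type)) (aOf i)) (lineDelta_ne_zero (imagUnit_ne_zero (F : Type)) (aOf i))
            (lineDelta_mul_self (imagUnit_mul_self (F : Type)) (aOf i)) (conj_lineDelta (complexConj_imagUnit (F : Type)) (aOf j)) (lineDelta_ne_zero (imagUnit_ne_zero (F : Type)) (aOf j))
            (lineDelta_mul_self (imagUnit_mul_self (F : Type)) (aOf j)) x (realDiagonal (F : Type) dV hdV) (realDiagonal_isSymm (F : Type) dV hdV) (isUnit_det_realDiagonal (F : Type) dV hdV hdV0) hx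
            (lineTransportSection ↥(maximalRealSubfield (F : Type)) (F : Type) (IsCMField.complexConj (F : Type)) 3 (complexConj_imagUnit (F : Type)) (imagUnit_ne_zero (F : Type)) (imagUnit_mul_self (F : Type)) (realDiagonal (F : Type) dV hdV) (realDiagonal_isSymm (F : Type) dV hdV) (Matrix.diagonal dV) (realDiagonal_map (F : Type) dV hdV).symm (aOf i) v ((OmegaChiSplitting.chiLocalSplittingsD ⟨HodgeCM.CMField.K F⟩ e₁ dV hdV hdV0 (toHeckeCharacter (F : Type) (ψ i)) ((isOscillatorChar_toHeckeCharacter_iff (ψ i)).mpr (hψ i)) (aOf i)).s v) ((OmegaChiSplitting.chiLocalSplittingsD ⟨HodgeCM.CMField.K F⟩ e₁ dV hdV hdV0 (toHeckeCharacter (F : Type) (ψ i)) ((isOscillatorChar_toHeckeCharacter_iff (ψ i)).mpr (hψ i)) (aOf i)).proj_s v)) =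
          (lineTransportSection ↥(maximalRealSubfield (F : Type)) (F : Type) (IsCMField.complexConj (F : Type)) 3 (complexConj_imagUnit (F : Type)) (imagUnit_ne_zero (F : Type)) (imagUnit_mul_self (F : Type)) (realDiagonal (F : Type) dV hdV) (realDiagonal_isSymm (F : Type) dV hdV) (Matrix.diagonal dV) (realDiagonal_map (F : Type) dV hdV).symm (aOf j) v ((OmegaChiSplitting.chiLocalSplittingsD ⟨HodgeCM.CMField.K F⟩ e₁ dV hdV hdV0 (toHeckeCharacter (F : Type) (ψ j)) ((isOscillatorChar_toHeckeCharacter_iff (ψ j)).mpr (hψ j)) (aOf j)).s v) ((OmegaChiSplitting.chiLocalSplittingsD ⟨HodgeCM.CMField.K F⟩ e₁ dV hdV hdV0 (toHeckeCharacter (F : Type) (ψ j)) ((isOscillatorChar_toHeckeCharacter_iff (ψ j)).mpr (hψ j)) (aOf j)).proj_s v))) →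
        localMu (F : Type) (toHeckeCharacter (F : Type) (ψ j)) v = localMu (F : Type) (toHeckeCharacter (F : Type) (ψ i)) v) →
      ¬ IsField (UnitaryGroup.LocalRing (F : Type) v) →
      ∀ i j : ι,
        AreIsomorphicRep ((Def411WeilCarriers.localIndexedFamilyAtV (ι := ι) ↥(maximalRealSubfield (F : Type)) (F : Type) (IsCMField.complexConj (F : Type)) 3 e₁ (Matrix.diagonal dV) (complexConj_imagUnit (F : Type)) (imagUnit_ne_zero (F : Type)) (imagUnit_mul_self (F : Type)) (realDiagonal_isSymm (F : Type) dV hdV) (isUnit_det_realDiagonal (F : Type) dV hdV hdV0) (realDiagonal_map (F : Type) dV hdV).symm (le_refl 3) aOf χOf (fun t => OmegaChiSplitting.chiLocalSplittingsD ⟨HodgeCM.CMField.K F⟩ e₁ dV hdV hdV0 (toHeckeCharacter (F : Type) (ψ t)) ((isOscillatorChar_toHeckeCharacter_iff (ψ t)).mpr (hψ t)) (aOf t)) (fun t => localMu (F : Type) (toHeckeCharacter (F : Type) (ψ t))) (fun t v x => norm_localMu (F : Type) (toHeckeCharacter (F : Type) (ψ t)) v (isUnitary_toHeckeCharacter (F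 : Type) (ψ t)) x) (fun t => continuous_localMu (F : Type) (toHeckeCharacter (F : Type) (ψ t))) (fun t v x => localMu_toLocalRing_eq_one_iff (F : Type) (toHeckeCharacter (F : Type) (ψ t)) v ((isOscillatorChar_toHeckeCharacter_iff (ψ t)).mpr (hψ t)) x) v).quot j) ((Def411WeilCarriers.localIndexedFamilyAtV (ι := ι) ↥(maximalRealSubfield (F : Type)) (F : Type) (IsCMField.complexConj (F : Type)) 3 e₁ (Matrix.diagonal dV) (complexConj_imagUnit (F : Type)) (imagUnit_ne_zero (F : Type)) (imagUnit_mul_self (F : Type)) (realDiagonal_isSymm (F : Type) dV hdV) (isUnit_det_realDiagonal (F : Type) dV hdV hdV0) (realDiagonal_map (F : Type) dV hdV).symm (le_refl 3) aOf χOf (fun t => OmegaChiSplitting.chiLocalSplittingsD ⟨HodgeCM.CMField.K F⟩ e₁ dV hdV hdV0 (toHeckeCharacter (F : Type) (ψ t)) ((isOscillatorChar_toHeckeCharacter_iff (ψ t)).mpr (hψ t)) (aOf t)) (fun t => localMu (F : Type) (toHeckeCharacter (F : Type) (ψ t))) (fun t v x => norm_localMu (F : Type) (toHeckeCharacter (F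 : Type) (ψ t)) v (isUnitary_toHeckeCharacter (F : Type) (ψ t)) x) (fun t => continuous_localMu (F : Type) (toHeckeCharacter (F : Type) (ψ t))) (fun t v x => localMu_toLocalRing_eq_one_iff (F : Type) (toHeckeCharacter (F : Type) (ψ t)) v ((isOscillatorChar_toHeckeCharacter_iff (ψ t)).mpr (hψ t)) x) v).quot i) →
        (Def411WeilCarriers.localIndexedFamilyAtV (ι := ι) ↥(maximalRealSubfield (F : Type)) (F : Type) (IsCMField.complexConj (F : Type)) 3 e₁ (Matrix.diagonal dV) (complexConj_imagUnit (F : Type)) (imagUnit_ne_zero (F : Type)) (imagUnit_mul_self (F : Type)) (realDiagonal_isSymm (F : Type) dV hdV) (isUnit_det_realDiagonal (F : Type) dV hdV hdV0) (realDiagonal_map (F : Type) dV hdV).symm (le_refl 3) aOf χOf (fun t => OmegaChiSplitting.chiLocalSplittingsD ⟨HodgeCM.CMField.K F⟩ e₁ dV hdV hdV0 (toHeckeCharacter (F : Type) (ψ t)) ((isOscillatorChar_toHeckeCharacter_iff (ψ t)).mpr (hψ t)) (aOf t)) (fun t => localMu (F : Type) (toHeckeCharacter (F : Type) (ψ t)))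 (fun t v x => norm_localMu (F : Type) (toHeckeCharacter (F : Type) (ψ t)) v (isUnitary_toHeckeCharacter (F : Type) (ψ t)) x) (fun t => continuous_localMu (F : Type) (toHeckeCharacter (F : Type) (ψ t))) (fun t v x => localMu_toLocalRing_eq_one_iff (F : Type) (toHeckeCharacter (F : Type) (ψ t)) v ((isOscillatorChar_toHeckeCharacter_iff (ψ t)).mpr (hψ t)) x) v).mu j = (Def411WeilCarriers.localIndexedFamilyAtV (ι := ι) ↥(maximalRealSubfield (F : Type)) (F : Type) (IsCMField.complexConj (F : Type)) 3 e₁ (Matrix.diagonal dV) (complexConj_imagUnit (F : Type)) (imagUnit_ne_zero (F : Type)) (imagUnit_mul_self (F : Type)) (realDiagonal_isSymm (F : Type) dV hdV) (isUnit_det_realDiagonal (F : Type) dV hdV hdV0) (realDiagonal_map (F : Type) dV hdV).symm (le_refl 3) aOf χOf (fun t => OmegaChiSplitting.chiLocalSplittingsD ⟨HodgeCM.CMField.K F⟩ e₁ dV hdV hdV0 (toHeckeCharacter (F : Type) (ψ t)) ((isOscillatorChar_toHeckeCharacter_iff (ψ t)).mpr (hψ t)) (aOf t)) (fun t => localMu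 (F : Type) (toHeckeCharacter (F : Type) (ψ t))) (fun t v x => norm_localMu (F : Type) (toHeckeCharacter (F : Type) (ψ t)) v (isUnitary_toHeckeCharacter (F : Type) (ψ t)) x) (fun t => continuous_localMu (F : Type) (toHeckeCharacter (F : Type) (ψ t))) (fun t v x => localMu_toLocalRing_eq_one_iff (F : Type) (toHeckeCharacter (F : Type) (ψ t)) v ((isOscillatorChar_toHeckeCharacter_iff (ψ t)).mpr (hψ t)) x) v).mu i ∧
          (Def411WeilCarriers.localIndexedFamilyAtV (ι := ι) ↥(maximalRealSubfield (F : Type)) (F : Type) (IsCMField.complexConj (F : Type)) 3 e₁ (Matrix.diagonal dV) (complexConj_imagUnit (F : Type)) (imagUnit_ne_zero (F : Type)) (imagUnit_mul_self (F : Type)) (realDiagonal_isSymm (F : Type) dV hdV) (isUnit_det_realDiagonal (F : Type) dV hdV hdV0) (realDiagonal_map (F : Type) dV hdV).symm (le_refl 3) aOf χOf (fun t => OmegaChiSplitting.chiLocalSplittingsD ⟨HodgeCM.CMField.K F⟩ e₁ dV hdV hdV0 (toHeckeCharacter (F : Type) (ψ t)) ((isOscillatorChar_toHeckeCharacter_iff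 (ψ t)).mpr (hψ t)) (aOf t)) (fun t => localMu (F : Type) (toHeckeCharacter (F : Type) (ψ t))) (fun t v x => norm_localMu (F : Type) (toHeckeCharacter (F : Type) (ψ t)) v (isUnitary_toHeckeCharacter (F : Type) (ψ t)) x) (fun t => continuous_localMu (F : Type) (toHeckeCharacter (F : Type) (ψ t))) (fun t v x => localMu_toLocalRing_eq_one_iff (F : Type) (toHeckeCharacter (F : Type) (ψ t)) v ((isOscillatorChar_toHeckeCharacter_iff (ψ t)).mpr (hψ t)) x) v).chi j = (Def411WeilCarriers.localIndexedFamilyAtV (ι := ι) ↥(maximalRealSubfield (F : Type)) (F : Type) (IsCMField.complexConj (F : Type)) 3 e₁ (Matrix.diagonal dV) (complexConj_imagUnit (F : Type)) (imagUnit_ne_zero (F : Type)) (imagUnit_mul_self (F : Type)) (realDiagonal_isSymm (F : Type) dV hdV) (isUnit_det_realDiagonal (F : Type) dV hdV hdV0) (realDiagonal_map (F : Type) dV hdV).symm (le_refl 3) aOf χOf (fun t => OmegaChiSplitting.chiLocalSplittingsD ⟨HodgeCM.CMField.K F⟩ e₁ dV hdV hdV0 (toHeckeCharacter (F : Type) (ψ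 t)) ((isOscillatorChar_toHeckeCharacter_iff (ψ t)).mpr (hψ t)) (aOf t)) (fun t => localMu (F : Type) (toHeckeCharacter (F : Type) (ψ t))) (fun t v x => norm_localMu (F : Type) (toHeckeCharacter (F : Type) (ψ t)) v (isUnitary_toHeckeCharacter (F : Type) (ψ t)) x) (fun t => continuous_localMu (F : Type) (toHeckeCharacter (F : Type) (ψ t))) (fun t v x => localMu_toLocalRing_eq_one_iff (F : Type) (toHeckeCharacter (F : Type) (ψ t)) v ((isOscillatorChar_toHeckeCharacter_iff (ψ t)).mpr (hψ t)) x) v).chi i := by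
  intro F dV hdV hdV0 ι ψ hψ aOf χOf v hK hE i j hiso
  letI : MeasurableSpace (v.adicCompletion ↥(maximalRealSubfield (HodgeCM.CMField.K F))) :=
    (GRConstruction.borelPlaceMeasure (HodgeCM.CMField.K F) v).mS
  haveI : BorelSpace (v.adicCompletion ↥(maximalRealSubfield (HodgeCM.CMField.K F))) :=
    (GRConstruction.borelPlaceMeasure (HodgeCM.CMField.K F) v).isBorel
  haveI : (GRConstruction.borelPlaceMeasure (HodgeCM.CMField.K F) v).μ.IsAddHaarMeasure :=
    (GRConstruction.borelPlaceMeasure (HodgeCM.CMField.K F) v).isHaar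
  exact Def411WeilCarriers.mu_and_chi_eq_of_areIsomorphicRep_split_of_facts ↥(maximalRealSubfield (F : Type)) (F : Type) (IsCMField.complexConj (F : Type)) (Matrix.diagonal dV) (complexConj_imagUnit (F : Type)) (imagUnit_ne_zero (F : Type)) (imagUnit_mul_self (F : Type))
    h4 hIV3a hIV3b (realDiagonal_isSymm (F : Type) dV hdV) (isUnit_det_realDiagonal (F : Type) dV hdV hdV0) (realDiagonal_map (F : Type) dV hdV).symm aOf χOf
    (fun t => OmegaChiSplitting.chiLocalSplittingsD ⟨HodgeCM.CMField.K F⟩ e₁ dV hdV hdV0 (toHeckeCharacter (F : Type) (ψ t)) ((isOscillatorChar_toHeckeCharacter_iff (ψ t)).mpr (hψ t)) (aOf t))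
    (fun t => localMu (F : Type) (toHeckeCharacter (F : Type) (ψ t)))
    (fun t v x => norm_localMu (F : Type) (toHeckeCharacter (F : Type) (ψ t)) v (isUnitary_toHeckeCharacter (F : Type) (ψ t)) x)
    (fun t => continuous_localMu (F : Type) (toHeckeCharacter (F : Type) (ψ t)))
    (fun t v x => localMu_toLocalRing_eq_one_iff (F : Type) (toHeckeCharacter (F : Type) (ψ t)) v ((isOscillatorChar_toHeckeCharacter_iff (ψ t)).mpr (hψ t)) x)
    v hE (GRConstruction.borelPlaceMeasure (HodgeCM.CMField.K F) v).μ
    (fun t => GRConstruction.isL2Isometric_omegaLoc_congrW_undoubledSplittings_cmFinLocalFamily _ _ _ _ _ _ _ _ _ _ _ v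
      (isUnitary_toHeckeCharacter (F : Type) (ψ t)) _ _ _ _ _)
    i j (hK i j) hiso

set_option maxHeartbeats 1600000 in
/-- **Line `a4-liuD3`, stub (:195) `SplitInjective`, PROVED MODULO KUDLA'S LOCAL INJECTIVITY ONLY** — the three interface facts of
`splitInjective_of_facts` are now THEOREMS of the tree and are supplied by name: IV-4c4 `rankOne_theta_twist_rigidity_split_holds`
(B-p17 p603567), IV-3(a) `Liu2021.splitPlace_chiCoinv_iso_parabolicIndGL_holds` (B-p08 p603198), IV-3(b)
`Zelevinsky1980.parabolicIndGL_detChar_unitary_isIrreducible_holds` (B-p09 p601139).  What remains in the statement is the single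
analytic input `hK` (Kudla's local injectivity in transported form, cell item F2 `LocalKudlaSplittingUniqueness`): for every CM field
`F`, frame `dV`, index maps and finite place `v` of `F⁺` split in `F`, `(∀ i j, hK i j) → ¬ IsField (F ⊗ F⁺_v) → ∀ i j,
AreIsomorphicRep (quot j) (quot i) → mu j = mu i ∧ chi j = chi i` on the family of record at `e₁` (`famAtV` unfolded).
[cite: Liu2021, App. D Lemma D.1 (3) (l. 5233), proof l. 5249–5254] [cite: Minguez2008, Thm. 1 p. 718]
[cite: MoeglinVignerasWaldspurger1987, Chap. 3 IV.4] -/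
theorem splitInjective_of_kudla :
    ∀ (F : HodgeCM.CMField) (dV : Fin 3 → (F : Type))
      (hdV : ∀ i, IsCMField.complexConj (F : Type) (dV i) = dV i) (hdV0 : ∀ i, dV i ≠ 0) {ι : Type}
      (ψ : ι → (Literature.NumberTheory.Automorphic.IdeleClassGroup (F : Type) →ₜ* Circle))
      (hψ : ∀ t, IdeleClassGroup.IsConjugateSymplectic (F : Type) (ψ t))
      (aOf : ι → (↥(maximalRealSubfield (F : Type)))ˣ)
      (χOf : ι → Def411WeilCarriers.Chi ↥(maximalRealSubfield (F : Type)) (F : Type) (IsCMField.complexConj (F : Type)))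
      (v : IsDedekindDomain.HeightOneSpectrum (𝓞 ↥(maximalRealSubfield (F : Type)))),
      (∀ i j : ι,
        (∃ (x : (UnitaryGroup.LocalRing (F : Type) v)ˣ) (hx : algebraMap (F : Type) (UnitaryGroup.LocalRing (F : Type) v) (algebraMap ↥(maximalRealSubfield (F : Type)) (F : Type) (↑(aOf j)⁻¹ : ↥(maximalRealSubfield (F : Type))) * imagUnit (F : Type)) =
            (x : (UnitaryGroup.LocalRing (F : Type) v)) * UnitaryGroup.conjLocal (F : Type) (IsCMField.complexConj (F : Type)) v x * algebraMap (F : Type) (UnitaryGroup.LocalRing (F : Type) v) (algebraMap ↥(maximalRealSubfield (F : Type)) (F : Type) (↑(aOf i)⁻¹ : ↥(maximalRealSubfield (F : Type))) * imagUnit (F : Type))),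
          lineTransportSplitting (F : Type) v (IsCMField.complexConj (F : Type)) 3 (conj_lineDelta (complexConj_imagUnit (F : Type)) (aOf i)) (lineDelta_ne_zero (imagUnit_ne_zero (F : Type)) (aOf i))
            (lineDelta_mul_self (imagUnit_mul_self (F : Type)) (aOf i)) (conj_lineDelta (complexConj_imagUnit (F : Type)) (aOf j)) (lineDelta_ne_zero (imagUnit_ne_zero (F : Type)) (aOf j))
            (lineDelta_mul_self (imagUnit_mul_self (F : Type)) (aOf j)) x (realDiagonal (F : Type) dV hdV) (realDiagonal_isSymm (F : Type) dV hdV) (isUnit_det_realDiagonal (F : Type) dV hdV hdV0) hx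
            (lineTransportSection ↥(maximalRealSubfield (F : Type)) (F : Type) (IsCMField.complexConj (F : Type)) 3 (complexConj_imagUnit (F : Type)) (imagUnit_ne_zero (F : Type)) (imagUnit_mul_self (F : Type)) (realDiagonal (F : Type) dV hdV) (realDiagonal_isSymm (F : Type) dV hdV) (Matrix.diagonal dV) (realDiagonal_map (F : Type) dV hdV).symm (aOf i) v ((OmegaChiSplitting.chiLocalSplittingsD ⟨HodgeCM.CMField.K F⟩ e₁ dV hdV hdV0 (toHeckeCharacter (F : Type) (ψ i)) ((isOscillatorChar_toHeckeCharacter_iff (ψ i)).mpr (hψ i)) (aOf i)).s v) ((OmegaChiSplitting.chiLocalSplittingsD ⟨HodgeCM.CMField.K F⟩ e₁ dV hdV hdV0 (toHeckeCharacter (F : Type) (ψ i)) ((isOscillatorChar_toHeckeCharacter_iff (ψ i)).mpr (hψ i)) (aOf i)).proj_s v)) =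
          (lineTransportSection ↥(maximalRealSubfield (F : Type)) (F : Type) (IsCMField.complexConj (F : Type)) 3 (complexConj_imagUnit (F : Type)) (imagUnit_ne_zero (F : Type)) (imagUnit_mul_self (F : Type)) (realDiagonal (F : Type) dV hdV) (realDiagonal_isSymm (F : Type) dV hdV) (Matrix.diagonal dV) (realDiagonal_map (F : Type) dV hdV).symm (aOf j) v ((OmegaChiSplitting.chiLocalSplittingsD ⟨HodgeCM.CMField.K F⟩ e₁ dV hdV hdV0 (toHeckeCharacter (F : Type) (ψ j)) ((isOscillatorChar_toHeckeCharacter_iff (ψ j)).mpr (hψ j)) (aOf j)).s v) ((OmegaChiSplitting.chiLocalSplittingsD ⟨HodgeCM.CMField.K F⟩ e₁ dV hdV hdV0 (toHeckeCharacter (F : Type) (ψ j)) ((isOscillatorChar_toHeckeCharacter_iff (ψ j)).mpr (hψ j)) (aOf j)).proj_s v))) →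
        localMu (F : Type) (toHeckeCharacter (F : Type) (ψ j)) v = localMu (F : Type) (toHeckeCharacter (F : Type) (ψ i)) v) →
      ¬ IsField (UnitaryGroup.LocalRing (F : Type) v) →
      ∀ i j : ι,
        AreIsomorphicRep ((Def411WeilCarriers.localIndexedFamilyAtV (ι := ι) ↥(maximalRealSubfield (F : Type)) (F : Type) (IsCMField.complexConj (F : Type)) 3 e₁ (Matrix.diagonal dV) (complexConj_imagUnit (F : Type)) (imagUnit_ne_zero (F : Type)) (imagUnit_mul_self (F : Type)) (realDiagonal_isSymm (F : Type) dV hdV) (isUnit_det_realDiagonal (F : Type) dV hdV hdV0) (realDiagonal_map (F : Type) dV hdV).symm (le_refl 3) aOf χOf (fun t => OmegaChiSplitting.chiLocalSplittingsD ⟨HodgeCM.CMField.K F⟩ e₁ dV hdV hdV0 (toHeckeCharacter (F : Type) (ψ t)) ((isOscillatorChar_toHeckeCharacter_iff (ψ t)).mpr (hψ t)) (aOf t)) (fun t => localMu (F : Type) (toHeckeCharacter (F : Type) (ψ t))) (fun t v x => norm_localMu (F : Type) (toHeckeCharacter (F : Type) (ψ t)) v (isUnitary_toHeckeCharacter (F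 : Type) (ψ t)) x) (fun t => continuous_localMu (F : Type) (toHeckeCharacter (F : Type) (ψ t))) (fun t v x => localMu_toLocalRing_eq_one_iff (F : Type) (toHeckeCharacter (F : Type) (ψ t)) v ((isOscillatorChar_toHeckeCharacter_iff (ψ t)).mpr (hψ t)) x) v).quot j) ((Def411WeilCarriers.localIndexedFamilyAtV (ι := ι) ↥(maximalRealSubfield (F : Type)) (F : Type) (IsCMField.complexConj (F : Type)) 3 e₁ (Matrix.diagonal dV) (complexConj_imagUnit (F : Type)) (imagUnit_ne_zero (F : Type)) (imagUnit_mul_self (F : Type)) (realDiagonal_isSymm (F : Type) dV hdV) (isUnit_det_realDiagonal (F : Type) dV hdV hdV0) (realDiagonal_map (F : Type) dV hdV).symm (le_refl 3) aOf χOf (fun t => OmegaChiSplitting.chiLocalSplittingsD ⟨HodgeCM.CMField.K F⟩ e₁ dV hdV hdV0 (toHeckeCharacter (F : Type) (ψ t)) ((isOscillatorChar_toHeckeCharacter_iff (ψ t)).mpr (hψ t)) (aOf t)) (fun t => localMu (F : Type) (toHeckeCharacter (F : Type) (ψ t))) (fun t v x => norm_localMu (F : Type) (toHeckeCharacter (F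 : Type) (ψ t)) v (isUnitary_toHeckeCharacter (F : Type) (ψ t)) x) (fun t => continuous_localMu (F : Type) (toHeckeCharacter (F : Type) (ψ t))) (fun t v x => localMu_toLocalRing_eq_one_iff (F : Type) (toHeckeCharacter (F : Type) (ψ t)) v ((isOscillatorChar_toHeckeCharacter_iff (ψ t)).mpr (hψ t)) x) v).quot i) →
        (Def411WeilCarriers.localIndexedFamilyAtV (ι := ι) ↥(maximalRealSubfield (F : Type)) (F : Type) (IsCMField.complexConj (F : Type)) 3 e₁ (Matrix.diagonal dV) (complexConj_imagUnit (F : Type)) (imagUnit_ne_zero (F : Type)) (imagUnit_mul_self (F : Type)) (realDiagonal_isSymm (F : Type) dV hdV) (isUnit_det_realDiagonal (F : Type) dV hdV hdV0) (realDiagonal_map (F : Type) dV hdV).symm (le_refl 3) aOf χOf (fun t => OmegaChiSplitting.chiLocalSplittingsD ⟨HodgeCM.CMField.K F⟩ e₁ dV hdV hdV0 (toHeckeCharacter (F : Type) (ψ t)) ((isOscillatorChar_toHeckeCharacter_iff (ψ t)).mpr (hψ t)) (aOf t)) (fun t => localMu (F : Type) (toHeckeCharacter (F : Type) (ψ t)))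 (fun t v x => norm_localMu (F : Type) (toHeckeCharacter (F : Type) (ψ t)) v (isUnitary_toHeckeCharacter (F : Type) (ψ t)) x) (fun t => continuous_localMu (F : Type) (toHeckeCharacter (F : Type) (ψ t))) (fun t v x => localMu_toLocalRing_eq_one_iff (F : Type) (toHeckeCharacter (F : Type) (ψ t)) v ((isOscillatorChar_toHeckeCharacter_iff (ψ t)).mpr (hψ t)) x) v).mu j = (Def411WeilCarriers.localIndexedFamilyAtV (ι := ι) ↥(maximalRealSubfield (F : Type)) (F : Type) (IsCMField.complexConj (F : Type)) 3 e₁ (Matrix.diagonal dV) (complexConj_imagUnit (F : Type)) (imagUnit_ne_zero (F : Type)) (imagUnit_mul_self (F : Type)) (realDiagonal_isSymm (F : Type) dV hdV) (isUnit_det_realDiagonal (F : Type) dV hdV hdV0) (realDiagonal_map (F : Type) dV hdV).symm (le_refl 3) aOf χOf (fun t => OmegaChiSplitting.chiLocalSplittingsD ⟨HodgeCM.CMField.K F⟩ e₁ dV hdV hdV0 (toHeckeCharacter (F : Type) (ψ t)) ((isOscillatorChar_toHeckeCharacter_iff (ψ t)).mpr (hψ t)) (aOf t)) (fun t => localMu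 (F : Type) (toHeckeCharacter (F : Type) (ψ t))) (fun t v x => norm_localMu (F : Type) (toHeckeCharacter (F : Type) (ψ t)) v (isUnitary_toHeckeCharacter (F : Type) (ψ t)) x) (fun t => continuous_localMu (F : Type) (toHeckeCharacter (F : Type) (ψ t))) (fun t v x => localMu_toLocalRing_eq_one_iff (F : Type) (toHeckeCharacter (F : Type) (ψ t)) v ((isOscillatorChar_toHeckeCharacter_iff (ψ t)).mpr (hψ t)) x) v).mu i ∧
          (Def411WeilCarriers.localIndexedFamilyAtV (ι := ι) ↥(maximalRealSubfield (F : Type)) (F : Type) (IsCMField.complexConj (F : Type)) 3 e₁ (Matrix.diagonal dV) (complexConj_imagUnit (F : Type)) (imagUnit_ne_zero (F : Type)) (imagUnit_mul_self (F : Type)) (realDiagonal_isSymm (F : Type) dV hdV) (isUnit_det_realDiagonal (F : Type) dV hdV hdV0) (realDiagonal_map (F : Type) dV hdV).symm (le_refl 3) aOf χOf (fun t => OmegaChiSplitting.chiLocalSplittingsD ⟨HodgeCM.CMField.K F⟩ e₁ dV hdV hdV0 (toHeckeCharacter (F : Type) (ψ t)) ((isOscillatorChar_toHeckeCharacter_iff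 (ψ t)).mpr (hψ t)) (aOf t)) (fun t => localMu (F : Type) (toHeckeCharacter (F : Type) (ψ t))) (fun t v x => norm_localMu (F : Type) (toHeckeCharacter (F : Type) (ψ t)) v (isUnitary_toHeckeCharacter (F : Type) (ψ t)) x) (fun t => continuous_localMu (F : Type) (toHeckeCharacter (F : Type) (ψ t))) (fun t v x => localMu_toLocalRing_eq_one_iff (F : Type) (toHeckeCharacter (F : Type) (ψ t)) v ((isOscillatorChar_toHeckeCharacter_iff (ψ t)).mpr (hψ t)) x) v).chi j = (Def411WeilCarriers.localIndexedFamilyAtV (ι := ι) ↥(maximalRealSubfield (F : Type)) (F : Type) (IsCMField.complexConj (F : Type)) 3 e₁ (Matrix.diagonal dV) (complexConj_imagUnit (F : Type)) (imagUnit_ne_zero (F : Type)) (imagUnit_mul_self (F : Type)) (realDiagonal_isSymm (F : Type) dV hdV) (isUnit_det_realDiagonal (F : Type) dV hdV hdV0) (realDiagonal_map (F : Type) dV hdV).symm (le_refl 3) aOf χOf (fun t => OmegaChiSplitting.chiLocalSplittingsD ⟨HodgeCM.CMField.K F⟩ e₁ dV hdV hdV0 (toHeckeCharacter (F : Type) (ψ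 t)) ((isOscillatorChar_toHeckeCharacter_iff (ψ t)).mpr (hψ t)) (aOf t)) (fun t => localMu (F : Type) (toHeckeCharacter (F : Type) (ψ t))) (fun t v x => norm_localMu (F : Type) (toHeckeCharacter (F : Type) (ψ t)) v (isUnitary_toHeckeCharacter (F : Type) (ψ t)) x) (fun t => continuous_localMu (F : Type) (toHeckeCharacter (F : Type) (ψ t))) (fun t v x => localMu_toLocalRing_eq_one_iff (F : Type) (toHeckeCharacter (F : Type) (ψ t)) v ((isOscillatorChar_toHeckeCharacter_iff (ψ t)).mpr (hψ t)) x) v).chi i :=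
  splitInjective_of_facts Literature.RepresentationTheory.MoeglinVignerasWaldspurger1987.rankOne_theta_twist_rigidity_split_holds
    Liu2021.splitPlace_chiCoinv_iso_parabolicIndGL_holds
    Zelevinsky1980.parabolicIndGL_detChar_unitary_isIrreducible_holds.{0}

end Summit.HodgeConjecture.CorCM.HypD3

end
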